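import Summits.QuantumFields.YangMills.Theorems.FlatTubeReductionFarPairKernels
import Summits.QuantumFields.YangMills.Theorems.LuscherReductionRunningReductionOrbitDist
import Summits.QuantumFields.YangMills.Theorems.LuscherReductionTwistedTraceScalingGaugeSliceKernel
import Summits.QuantumFields.YangMills.Theorems.LuscherReductionTwistedTraceScalingSlowShadow
import HarnessLib

/-!
# (ρ2) THE ONE-SITE KERNEL SMEARS THE SQUARED ORBIT DISTANCE BY AT MOST ITS WIDTH: `∫ orbitDist(u')²·K̃₁^{(B)}(u,u') du' ≤ 2(orbitDist(u)² + m²)·∫K̃₁(u,·) + (4|E₁|)²·crossBound 1 B m`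
# (route `FlatTubeReduction`, crux K1 `NearFlatRatioLaw` stmt-QuantumFields-24720, line «ratepack_v2» skeleton v6, stub `stub_hODpot_A`; seat `ym-line-ftr-p1` g18; memo
# `Cruxes/NearFlatRatioLaw/Lines/ratepack-v7-moments-g18.md` §3 (c); R2b1 RECORD rung — no summit statement is proved here)

WHY.  The (C2-moments) transport of `stub_hODpot_A` runs through the OUTPUT diagonal (lane A's exact transport identity), so its first-order colour term carries `orbitDist u'` of the
OUTPUT slow datum, while the potential of `stub_hODpot_A` is `∫ orbitDist(u)²φ(u)²du` in the INPUT datum.  The two are exchanged through the gauge-averaged one-site kernel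
`K̃₁^{(B)}(u,u') = avgKernel B u u'` (`B = L³β`), which is Gaussian-small on FAR pairs (`…FarPairKernels.avgKernel_one_site_far_le`: `≤ crossBound 1 B m = e^{6B}e^{−Bm²/6}` when every
conjugate of `u'` is `m`-far from `u`) while on NEAR pairs `orbitDist u' ≤ orbitDist u + m` (`…OrbitDist.abs_orbitDist_sub_le` + gauge invariance):
★★ `integral_orbitDist_sq_mul_avgKernel_le` — for `B, m ≥ 0` and every `u`,
`∫ orbitDist(u')²·avgKernel B u u' du' ≤ 2(orbitDist(u)² + m²)·∫ avgKernel B u u' du' + (4|Edge 3 1|)²·crossBound 1 B m`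
(with `m² = 6κ log B/B` the far term is `e^{6B}B^{−κ}`, negligible against `∫K̃₁ ≍ e^{6B}B^{-9/2}`; memo v7 §3 (c)).
* §1 `orbitDist_le_four_card` (`orbitDist w ≤ 4|E|`), `orbitDist_le_add_of_near` (near pairs), the pointwise dichotomy `orbitDist_sq_mul_avgKernel_le`;
* §2 ★★ `integral_orbitDist_sq_mul_avgKernel_le`.
HONEST FRAMING: elementary kernel bookkeeping for a stub of the CONDITIONAL reduction route R2b1 (rate twin); femto rung R2b1 (RECORD label); not infinite volume, not a mass gap, not Clay.
No defs, no named facts, no `sorry`.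
-/

set_option autoImplicit false

noncomputable section

open MeasureTheory Filter Topology Real
open scoped BigOperators
open Literature.MathematicalPhysics.QuantumFieldTheory
open Literature.MathematicalPhysics.QuantumLattice

namespace Summit.QuantumFields.YangMills.Theorems.FemtoTransferGap.TwoLattice.ConstTube

open Summit.QuantumFields.YangMills.Theorems.FemtoTransferGap
open Summit.QuantumFields.YangMills.Theorems.FemtoTransferGap.TwoLattice
open Summit.QuantumFields.YangMills.Theorems.FemtoTransferGap.TwoLattice.Avg

variable {L : ℕ} [NeZero L]

/-! ## §1 Pointwise facts -/

/-- `orbitDist w ≤ 4·|E|` for every configuration (each link is within Frobenius distance `4` of `1`). [folklore] -/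
theorem orbitDist_le_four_card (w : GaugeConfig 3 L SU2) : orbitDist w ≤ 4 * (Fintype.card (Edge 3 L) : ℝ) := by
  have h1 : orbitDist w ≤ gaugeDist (fun _ : Site 3 L => (1 : SU2)) w := orbitDist_le _ _
  have h2 : gaugeDist (fun _ : Site 3 L => (1 : SU2)) w = ∑ e : Edge 3 L, frobNorm (((w e : SU2) : Matrix (Fin 2) (Fin 2) ℂ) - 1) := by
    unfold gaugeDist
    refine Finset.sum_congr rfl fun e _ => ?_
    rw [gaugeTransform_const_apply]; simp
  have h3 : ∀ e : Edge 3 L, frobNorm (((w e : SU2) : Matrix (Fin 2) (Fin 2) ℂ) - 1) ≤ 4 := fun e => by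
    have h := frobNorm_sub_one_le_two_norm (w e)
    have h' : ‖su2Quat (w e) - 1‖ ≤ 2 := by
      calc ‖su2Quat (w e) - 1‖ ≤ ‖su2Quat (w e)‖ + ‖(1 : Quaternion ℝ)‖ := norm_sub_le _ _
        _ = 2 := by rw [norm_su2Quat, norm_one]; norm_num
    linarith
  rw [h2] at h1
  calc orbitDist w ≤ ∑ e : Edge 3 L, frobNorm (((w e : SU2) : Matrix (Fin 2) (Fin 2) ℂ) - 1) := h1
    _ ≤ ∑ _e : Edge 3 L, (4 : ℝ) := Finset.sum_le_sum fun e _ => h3 e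
    _ = 4 * (Fintype.card (Edge 3 L) : ℝ) := by rw [Finset.sum_const, Finset.card_univ, nsmul_eq_mul, mul_comm]

/-- **Near pairs**: if some conjugate of `u'` is within `Σ_e ‖u_e − c u'_e c⁻¹‖_F ≤ d` of `u`, then `orbitDist u' ≤ orbitDist u + d`. [folklore] -/
theorem orbitDist_le_add_of_near (u u' : GaugeConfig 3 1 SU2) (c : SU2) {d : ℝ}
    (hd : ∑ e : Edge 3 1, frobNorm (((u e : SU2) : Matrix (Fin 2) (Fin 2) ℂ) - ((c * u' e * c⁻¹ : SU2) : Matrix (Fin 2) (Fin 2) ℂ)) ≤ d) :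
    orbitDist u' ≤ orbitDist u + d := by
  have h1 : orbitDist u' = orbitDist (gaugeTransform (fun _ : Site 3 1 => c) u') := (orbitDist_gaugeTransform _ _).symm
  have h2 := abs_orbitDist_sub_le (gaugeTransform (fun _ : Site 3 1 => c) u') u
  have h3 : ∑ e : Edge 3 1, frobNorm (((gaugeTransform (fun _ : Site 3 1 => c) u' e : SU2) : Matrix (Fin 2) (Fin 2) ℂ) - ((u e : SU2) : Matrix (Fin 2) (Fin 2) ℂ)) =
      ∑ e : Edge 3 1, frobNorm (((u e : SU2) : Matrix (Fin 2) (Fin 2) ℂ) - ((c * u' e * c⁻¹ : SU2) : Matrix (Fin 2) (Fin 2) ℂ)) := by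
    refine Finset.sum_congr rfl fun e _ => ?_
    rw [gaugeTransform_const_apply, ← frobNorm_neg]; congr 1; abel
  rw [h3] at h2
  rw [h1]; linarith [(abs_le.mp h2).2]

/-- ★ **The pointwise dichotomy**: `orbitDist(u')²·K̃₁(u,u') ≤ 2(orbitDist(u)² + m²)·K̃₁(u,u') + (4|E|)²·crossBound 1 B m` (near: distance; far: Gaussian smallness). [folklore] -/
theorem orbitDist_sq_mul_avgKernel_le {B m : ℝ} (hB : 0 ≤ B) (hm : 0 ≤ m) (u u' : GaugeConfig 3 1 SU2) :
    orbitDist u' ^ 2 * avgKernel B u u' ≤ 2 * (orbitDist u ^ 2 + m ^ 2) * avgKernel B u u' + (4 * (Fintype.card (Edge 3 1) : ℝ)) ^ 2 * crossBound 1 B m := by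
  have hK0 : 0 ≤ avgKernel B u u' := (avgKernel_pos _ _ _).le
  have hcb0 : 0 ≤ crossBound 1 B m := (crossBound_pos (L := 1) B m).le
  have hod0 : 0 ≤ orbitDist u := orbitDist_nonneg u
  have hod0' : 0 ≤ orbitDist u' := orbitDist_nonneg u'
  have hod4 := orbitDist_le_four_card u'
  by_cases hnear : ∃ c : SU2, ∑ e : Edge 3 1, frobNorm (((u e : SU2) : Matrix (Fin 2) (Fin 2) ℂ) - ((c * u' e * c⁻¹ : SU2) : Matrix (Fin 2) (Fin 2) ℂ)) < m
  · obtain ⟨c, hc⟩ := hnear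
    have h := orbitDist_le_add_of_near u u' c hc.le
    have hsq : orbitDist u' ^ 2 ≤ 2 * (orbitDist u ^ 2 + m ^ 2) := by nlinarith [sq_nonneg (orbitDist u - m)]
    nlinarith [mul_le_mul_of_nonneg_right hsq hK0, mul_nonneg (sq_nonneg (4 * (Fintype.card (Edge 3 1) : ℝ))) hcb0]
  · push Not at hnear
    have hfar := avgKernel_one_site_far_le hB hm u u' hnear
    have hsq : orbitDist u' ^ 2 ≤ (4 * (Fintype.card (Edge 3 1) : ℝ)) ^ 2 := pow_le_pow_left₀ hod0' hod4 2
    have h1 := mul_le_mul hsq hfar hK0 (sq_nonneg _)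
    have h2 := mul_nonneg (mul_nonneg (by norm_num : (0 : ℝ) ≤ 2) (add_nonneg (sq_nonneg (orbitDist u)) (sq_nonneg m))) hK0
    linarith [h1, h2]

/-! ## §2 ★★ The integrated statement -/

/-- ★★ **THE ONE-SITE KERNEL SMEARS `orbitDist²` BY AT MOST ITS WIDTH**: for `B, m ≥ 0` and every `u`,
`∫ orbitDist(u')²·avgKernel B u u' du' ≤ 2(orbitDist(u)² + m²)·∫ avgKernel B u u' du' + (4|Edge 3 1|)²·crossBound 1 B m`. [folklore] -/
theorem integral_orbitDist_sq_mul_avgKernel_le {B m : ℝ} (hB : 0 ≤ B) (hm : 0 ≤ m) (u : GaugeConfig 3 1 SU2) :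
    ∫ u', orbitDist u' ^ 2 * avgKernel B u u' ∂configMeasure SU2 1 ≤
      2 * (orbitDist u ^ 2 + m ^ 2) * ∫ u', avgKernel B u u' ∂configMeasure SU2 1 + (4 * (Fintype.card (Edge 3 1) : ℝ)) ^ 2 * crossBound 1 B m := by
  obtain ⟨M, hM⟩ := exists_transferKernel_le su2Rep continuous_su2Rep B (L := 1)
  have hKm : Measurable fun u' : GaugeConfig 3 1 SU2 => avgKernel B u u' := measurable_avgKernel_right B u
  have hK0 : ∀ u', 0 ≤ avgKernel B u u' := fun u' => (avgKernel_pos _ _ _).le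
  have hKb : ∀ u', |avgKernel B u u'| ≤ M := fun u' => by rw [abs_of_nonneg (hK0 u')]; exact avgKernel_le B hM u u'
  have hKint : Integrable (fun u' : GaugeConfig 3 1 SU2 => avgKernel B u u') (configMeasure SU2 1) := integrable_of_measurable_abs_le _ hKm hKb
  have hM0 : 0 ≤ M := (hK0 u).trans ((le_abs_self _).trans (hKb u))
  have hFm : Measurable fun u' : GaugeConfig 3 1 SU2 => orbitDist u' ^ 2 * avgKernel B u u' := (measurable_orbitDist.pow_const 2).mul hKm
  have hFb : ∀ u', |orbitDist u' ^ 2 * avgKernel B u u'| ≤ (4 * (Fintype.card (Edge 3 1) : ℝ)) ^ 2 * M := fun u' => by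
    rw [abs_of_nonneg (mul_nonneg (sq_nonneg _) (hK0 u'))]
    exact mul_le_mul (pow_le_pow_left₀ (orbitDist_nonneg u') (orbitDist_le_four_card u') 2) ((le_abs_self _).trans (hKb u')) (hK0 u') (sq_nonneg _)
  have hFint : Integrable (fun u' : GaugeConfig 3 1 SU2 => orbitDist u' ^ 2 * avgKernel B u u') (configMeasure SU2 1) := integrable_of_measurable_abs_le _ hFm hFb
  have hG : Integrable (fun u' : GaugeConfig 3 1 SU2 => 2 * (orbitDist u ^ 2 + m ^ 2) * avgKernel B u u' + (4 * (Fintype.card (Edge 3 1) : ℝ)) ^ 2 * crossBound 1 B m)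
      (configMeasure SU2 1) := (hKint.const_mul _).add (integrable_const _)
  calc ∫ u', orbitDist u' ^ 2 * avgKernel B u u' ∂configMeasure SU2 1
      ≤ ∫ u', (2 * (orbitDist u ^ 2 + m ^ 2) * avgKernel B u u' + (4 * (Fintype.card (Edge 3 1) : ℝ)) ^ 2 * crossBound 1 B m) ∂configMeasure SU2 1 :=
        integral_mono hFint hG fun u' => orbitDist_sq_mul_avgKernel_le hB hm u u'
    _ = 2 * (orbitDist u ^ 2 + m ^ 2) * ∫ u', avgKernel B u u' ∂configMeasure SU2 1 + (4 * (Fintype.card (Edge 3 1) : ℝ)) ^ 2 * crossBound 1 B m := by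
        rw [integral_add (hKint.const_mul _) (integrable_const _), integral_const_mul, integral_const, smul_eq_mul, probReal_univ, one_mul]


/-! ## Appended (g18, 03:55Z): polynomial slow weights -/

/-- ★ **Polynomial slow weights are smeared the same way**: for `B, m ≥ 0`, reals `a, b` and every `u`,
`∫ (a + b·orbitDist u')²·avgKernel B u u' du' ≤ (2a² + 4b²(orbitDist(u)² + m²))·∫ avgKernel B u u' du' + 2b²(4|Edge 3 1|)²·crossBound 1 B m`
(the shape of the squared first-order slow coefficients `γ_m(u',u)²` of `…CoreTransferMomentsCS`; memo v7 §5 (A1)/(A5)). [folklore] -/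
theorem integral_affine_orbitDist_sq_mul_avgKernel_le {B m : ℝ} (hB : 0 ≤ B) (hm : 0 ≤ m) (a b : ℝ) (u : GaugeConfig 3 1 SU2) :
    ∫ u', (a + b * orbitDist u') ^ 2 * avgKernel B u u' ∂configMeasure SU2 1 ≤
      (2 * a ^ 2 + 4 * b ^ 2 * (orbitDist u ^ 2 + m ^ 2)) * ∫ u', avgKernel B u u' ∂configMeasure SU2 1 +
        2 * b ^ 2 * ((4 * (Fintype.card (Edge 3 1) : ℝ)) ^ 2 * crossBound 1 B m) := by
  obtain ⟨M, hM⟩ := exists_transferKernel_le su2Rep continuous_su2Rep B (L := 1)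
  have hKm : Measurable fun u' : GaugeConfig 3 1 SU2 => avgKernel B u u' := measurable_avgKernel_right B u
  have hK0 : ∀ u', 0 ≤ avgKernel B u u' := fun u' => (avgKernel_pos _ _ _).le
  have hKb : ∀ u', |avgKernel B u u'| ≤ M := fun u' => by rw [abs_of_nonneg (hK0 u')]; exact avgKernel_le B hM u u'
  have hKint : Integrable (fun u' : GaugeConfig 3 1 SU2 => avgKernel B u u') (configMeasure SU2 1) := integrable_of_measurable_abs_le _ hKm hKb
  have hod : ∀ u' : GaugeConfig 3 1 SU2, |orbitDist u'| ≤ 4 * (Fintype.card (Edge 3 1) : ℝ) := fun u' => by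
    rw [abs_of_nonneg (orbitDist_nonneg u')]; exact orbitDist_le_four_card u'
  have hOm : Measurable fun u' : GaugeConfig 3 1 SU2 => orbitDist u' ^ 2 * avgKernel B u u' := (measurable_orbitDist.pow_const 2).mul hKm
  have hOb : ∀ u', |orbitDist u' ^ 2 * avgKernel B u u'| ≤ (4 * (Fintype.card (Edge 3 1) : ℝ)) ^ 2 * M := fun u' => by
    rw [abs_of_nonneg (mul_nonneg (sq_nonneg _) (hK0 u'))]
    exact mul_le_mul (pow_le_pow_left₀ (orbitDist_nonneg u') (orbitDist_le_four_card u') 2) ((le_abs_self _).trans (hKb u')) (hK0 u') (sq_nonneg _)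
  have hOint : Integrable (fun u' : GaugeConfig 3 1 SU2 => orbitDist u' ^ 2 * avgKernel B u u') (configMeasure SU2 1) := integrable_of_measurable_abs_le _ hOm hOb
  -- pointwise `(a + b·od)² ≤ 2a² + 2b²·od²`
  have hpt : ∀ u', (a + b * orbitDist u') ^ 2 * avgKernel B u u' ≤ 2 * a ^ 2 * avgKernel B u u' + 2 * b ^ 2 * (orbitDist u' ^ 2 * avgKernel B u u') := fun u' => by
    have h : (a + b * orbitDist u') ^ 2 ≤ 2 * a ^ 2 + 2 * b ^ 2 * orbitDist u' ^ 2 := by nlinarith [sq_nonneg (a - b * orbitDist u')]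
    have := mul_le_mul_of_nonneg_right h (hK0 u')
    linarith [this]
  have hAm : Measurable fun u' : GaugeConfig 3 1 SU2 => (a + b * orbitDist u') ^ 2 * avgKernel B u u' :=
    ((measurable_const.add (measurable_orbitDist.const_mul b)).pow_const 2).mul hKm
  have hAb : ∀ u', |(a + b * orbitDist u') ^ 2 * avgKernel B u u'| ≤ (|a| + |b| * (4 * (Fintype.card (Edge 3 1) : ℝ))) ^ 2 * M := fun u' => by
    rw [abs_mul, abs_of_nonneg (hK0 u'), abs_of_nonneg (sq_nonneg _)]
    have h1 : |a + b * orbitDist u'| ≤ |a| + |b| * (4 * (Fintype.card (Edge 3 1) : ℝ)) := by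
      calc |a + b * orbitDist u'| ≤ |a| + |b * orbitDist u'| := abs_add_le _ _
        _ = |a| + |b| * |orbitDist u'| := by rw [abs_mul]
        _ ≤ |a| + |b| * (4 * (Fintype.card (Edge 3 1) : ℝ)) := by have := mul_le_mul_of_nonneg_left (hod u') (abs_nonneg b); linarith
    have h2 : (a + b * orbitDist u') ^ 2 ≤ (|a| + |b| * (4 * (Fintype.card (Edge 3 1) : ℝ))) ^ 2 := by
      rw [← sq_abs (a + b * orbitDist u')]; exact pow_le_pow_left₀ (abs_nonneg _) h1 2
    exact mul_le_mul h2 ((le_abs_self _).trans (hKb u')) (hK0 u') (sq_nonneg _)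
  have hAint : Integrable (fun u' : GaugeConfig 3 1 SU2 => (a + b * orbitDist u') ^ 2 * avgKernel B u u') (configMeasure SU2 1) := integrable_of_measurable_abs_le _ hAm hAb
  have h1 : ∫ u', (a + b * orbitDist u') ^ 2 * avgKernel B u u' ∂configMeasure SU2 1 ≤
      2 * a ^ 2 * ∫ u', avgKernel B u u' ∂configMeasure SU2 1 + 2 * b ^ 2 * ∫ u', orbitDist u' ^ 2 * avgKernel B u u' ∂configMeasure SU2 1 := by
    have k1 : Integrable (fun u' : GaugeConfig 3 1 SU2 => 2 * a ^ 2 * avgKernel B u u') (configMeasure SU2 1) := hKint.const_mul _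
    have k2 : Integrable (fun u' : GaugeConfig 3 1 SU2 => 2 * b ^ 2 * (orbitDist u' ^ 2 * avgKernel B u u')) (configMeasure SU2 1) := hOint.const_mul _
    have hsum : Integrable (fun u' : GaugeConfig 3 1 SU2 => 2 * a ^ 2 * avgKernel B u u' + 2 * b ^ 2 * (orbitDist u' ^ 2 * avgKernel B u u')) (configMeasure SU2 1) := k1.add k2
    have h := integral_mono hAint hsum hpt
    have e : ∫ u', (2 * a ^ 2 * avgKernel B u u' + 2 * b ^ 2 * (orbitDist u' ^ 2 * avgKernel B u u')) ∂configMeasure SU2 1 =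
        2 * a ^ 2 * ∫ u', avgKernel B u u' ∂configMeasure SU2 1 + 2 * b ^ 2 * ∫ u', orbitDist u' ^ 2 * avgKernel B u u' ∂configMeasure SU2 1 := by
      rw [integral_add k1 k2, integral_const_mul, integral_const_mul]
    rw [e] at h
    exact h
  have h2 := integral_orbitDist_sq_mul_avgKernel_le hB hm u
  have hb2 : 0 ≤ 2 * b ^ 2 := by positivity
  nlinarith [h1, mul_le_mul_of_nonneg_left h2 hb2]

end Summit.QuantumFields.YangMills.Theorems.FemtoTransferGap.TwoLattice.ConstTube

end
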